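import Literature.AlgebraicGeometry.Motives.MotivatedCyclesPushforward
import HarnessLib

/-!
# Motivated classes are stable under push-forward along projections (proof)

This file discharges the named fact
`Literature.AlgebraicGeometry.Motives.WeilCohomology.motivatedClasses_map_pushforward_fst_le` of
`Motives/MotivatedCyclesPushforward.lean` (Y. André, *Pour une théorie inconditionnelle des
motifs*, Publ. Math. IHÉS 83 (1996), §2.1, Prop. 2.1 (ii), second inclusion
`pr_{X*}(A_mot(X × Z)_E) ⊆ A_mot(X)_E`, p. 14; proof p. 15), for the tree's motivated classes
`W.motivatedClasses` and the push-forward `W.pushforward hX (fst X Y)` (the Poincaré-duality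
adjoint of `pr_X^*`): `theorem motivatedClasses_map_pushforward_fst_le_holds`.

## The printed proof and its transcription

André's proof is one line (p. 15): «On a, d'autre part,
`pr^{XZ}_{X*} pr^{XZY}_{XZ*} (α ∪ ⋆β) = pr^{XZY}_{X*} (α ∪ ⋆β)`» — the push-forward to `X` of a
motivated class on `X × Z` with auxiliary variety `Y` *is* the motivated class on `X` with
auxiliary variety `Z × Y` given by the same data (functoriality of push-forwards,
`pr^{XZ}_X ∘ pr^{(XZ)Y}_{XZ} = pr^{X(ZY)}_X` up to the associativity isomorphism).

In the tree (`WeilCohomology.IsMotivatedClass`, relational form: the push-forward is expressed by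
the projection formula against all `y ∈ H^{2q}(X)`), for a generator `z = pr_{XY*}(α ∪ Sβ)` on
`X × Y` with auxiliary data `(Z, η, S, α, β)` living on `V = (X × Y) × Z`, the class
`x = pr_{X*} z` satisfies, for every `y`,
`tr_X (x ∪ y) = tr_{X×Y} (z ∪ pr_X^* y)` (`trace_cup_pushforward`, the adjunction defining
`W.pushforward`) `= tr_V ((α ∪ Sβ) ∪ pr^* pr_X^* y)` (motivatedness of `z`). It remains to move the
data along the associativity isomorphism `e = α_ X Y Z : V ≅ V' = X × (Y × Z)`:

* `isHyperplaneClass_pullback_of_isIso`: `e.inv^* η` is a hyperplane class of `V'` (compose the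
  projective embedding of `V` with the isomorphism);
* `isLefschetzStar_conj_of_iso`: `S' = e.inv^* ∘ S ∘ e.hom^*` is a Lefschetz `⋆` of `(V', e.inv^* η)`
  (pull-back along an isomorphism commutes with `L`, `pullback_lefschetzPow`, and preserves
  primitive classes, `isPrimitive_pullback_hom`);
* `e.inv^* α`, `e.inv^* β` are rational algebraic (axiom `pullback_ratAlgebraicClasses_le`), and
  `(e.inv^* α ∪ S' e.inv^* β) ∪ pr'^*_X y = e.inv^* ((α ∪ Sβ) ∪ pr^* pr_X^* y)` (`map_cup`,
  `pullback_comp`, `associator_inv_fst_fst`);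
* `trace_pullback_associator_inv`: `tr_{V'} ∘ e.inv^* = tr_V` in top degree — by Künneth induction
  (axiom (B)) twice, a top-degree class on `V` is a sum of triple external products
  `(a ⊠ b) ⊠ c`, which `e.inv^*` maps to `a ⊠ (b ⊠ c)` (`pullback_associator_inv_externalCup`);
  both have trace `tr a · tr b · tr c` (`trace_externalCup`) or vanish off the top multidegree
  (`externalCup_eq_zero_of_ne`).

Then `isMotivatedClass_pushforward_fst` (generators) and the discharge by linearity
(`Submodule.span_le`). Degree indices `(n + m) + l` versus `n + (m + l)` are reconciled by the
`subst` lemmas `trace_cup_cup_congr`, `trace_externalCup_of_eq`. Products of smooth projective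
varieties are smooth projective by `IsSmoothProjective.tensor_holds`. No statement of
`MotivatedCyclesPushforward.lean` is restated or modified; no new named facts.

## References

* Y. André, *Pour une théorie inconditionnelle des motifs*, Publ. Math. IHÉS 83 (1996) 5–49:
  §2.1 Déf. 1 and Prop. 2.1 (ii) (p. 14), proof of (ii) (p. 15). [`Andre1996Motifs`]
* S. Kleiman, *Algebraic cycles and the Weil conjectures* (1968), §1.2 (axioms (A), (B)),
  1.4.2 (`⋆`). [`Kleiman1968`]
* B. Kahn, *Zeta and L-functions of varieties and motives* (2020), §3.5.1 (push-forward as the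
  Poincaré-duality adjoint). [`Kahn2020`]
-/

universe u v

open CategoryTheory AlgebraicGeometry MonoidalCategory CartesianMonoidalCategory

noncomputable section

namespace Literature.AlgebraicGeometry.Motives

namespace WeilCohomology

variable {k : Type u} [Field k] {K : Type v} [Field K] [CharZero K] (W : WeilCohomology k K)

/-! ## Degree-index bookkeeping -/

section Congr

variable {V : SchemeOver k}

/-- Reindexing a trace of a double cup product along equal intermediate degree and equal
dimension index (the two sides differ only in the proofs of the degree equations). [folklore] -/
theorem trace_cup_cup_congr {i j l e₁ e₂ N₁ N₂ : ℕ} (he : e₁ = e₂) (hN : N₁ = N₂)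
    (g₁ : i + j = e₁) (g₂ : i + j = e₂) (h₁ : e₁ + l = 2 * N₁) (h₂ : e₂ + l = 2 * N₂)
    (A : W.obj V i) (B : W.obj V j) (C : W.obj V l) :
    W.trace V N₁ (W.cup h₁ (W.cup g₁ A B) C) = W.trace V N₂ (W.cup h₂ (W.cup g₂ A B) C) := by
  subst he hN
  rfl

variable {n m : ℕ} {X Y : SchemeOver k}

/-- The trace is multiplicative on external products of top-degree classes (axiom (B),
`trace_externalCup`), with the dimension index of `X × Y` written as any `N = n + m`. [folklore] -/
theorem trace_externalCup_of_eq (hX : IsSmoothProjective n X) (hY : IsSmoothProjective m Y)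
    {N : ℕ} (hN : n + m = N) (h : 2 * n + 2 * m = 2 * N) (a : W.obj X (2 * n))
    (b : W.obj Y (2 * m)) :
    W.trace (X ⊗ Y) N (W.externalCup X Y h a b) = W.trace X n a * W.trace Y m b := by
  subst hN
  exact W.trace_externalCup hX hY a b

end Congr

/-! ## Pull-back along isomorphisms: hyperplane classes, `L`, primitive classes, `⋆` -/

section Iso

variable {N M : ℕ} {V V' : SchemeOver k}

/-- A hyperplane class pulls back to a hyperplane class along an isomorphism (more generally along
a closed immersion): if `η = ι^* cl(D)` for a closed immersion `ι : V ↪ ℙⁿ`, then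
`ψ^* η = (ψ ≫ ι)^* cl(D)` and `ψ ≫ ι` is again a closed immersion. [folklore] -/
theorem isHyperplaneClass_pullback_of_isIso (ψ : V' ⟶ V) [IsIso ψ] {η : W.obj V 2}
    (hη : W.IsHyperplaneClass V η) : W.IsHyperplaneClass V' (W.pullback ψ 2 η) := by
  obtain ⟨e, D, hD, hD0, rfl⟩ := hη
  haveI : IsIso ψ.left := Functor.map_isIso (Over.forget _) ψ
  refine ⟨⟨e.n, ψ ≫ e.ι, ?_⟩, D, hD, hD0, ?_⟩
  · rw [Over.comp_left]
    infer_instance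
  · exact (LinearMap.congr_fun (W.pullback_comp ψ e.ι 2) _).symm

/-- `e.hom^* e.inv^* x = x` for an isomorphism `e`. [folklore] -/
theorem pullback_hom_pullback_inv (e : V ≅ V') (i : ℕ) (x : W.obj V i) :
    W.pullback e.hom i (W.pullback e.inv i x) = x := by
  rw [← LinearMap.comp_apply, ← W.pullback_comp, e.hom_inv_id, W.pullback_id, LinearMap.id_apply]

/-- `e.inv^* e.hom^* x = x` for an isomorphism `e`. [folklore] -/
theorem pullback_inv_pullback_hom (e : V ≅ V') (i : ℕ) (x : W.obj V' i) :
    W.pullback e.inv i (W.pullback e.hom i x) = x := by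
  rw [← LinearMap.comp_apply, ← W.pullback_comp, e.inv_hom_id, W.pullback_id, LinearMap.id_apply]

/-- Pull-back is compatible with powers of a degree-`2` class: `f^* (ηʳ) = (f^* η)ʳ`
(`map_one`, `map_cup`). [folklore] -/
theorem map_pow (hV' : IsSmoothProjective M V') (hV : IsSmoothProjective N V) (f : V' ⟶ V)
    (η : W.obj V 2) (r : ℕ) :
    W.pullback f (2 * r) (W.pow V η r) = W.pow V' (W.pullback f 2 η) r := by
  induction r with
  | zero => exact W.map_one hV' hV f
  | succ r ih =>
    rw [PreWeilCohomology.pow_succ, PreWeilCohomology.pow_succ, W.map_cup hV' hV f, ih]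

/-- Pull-back commutes with the iterated Lefschetz operators: `f^* (Lʳ_η x) = Lʳ_{f^* η} (f^* x)`. [folklore] -/
theorem pullback_lefschetzPow (hV' : IsSmoothProjective M V') (hV : IsSmoothProjective N V)
    (f : V' ⟶ V) (η : W.obj V 2) {r i j : ℕ} (h : i + 2 * r = j) (x : W.obj V i) :
    W.pullback f j (W.lefschetzPow V η r i j h x) =
      W.lefschetzPow V' (W.pullback f 2 η) r i j h (W.pullback f i x) := by
  simp only [PreWeilCohomology.lefschetzPow, LinearMap.flip_apply]
  rw [W.map_cup hV' hV f h, W.map_pow hV' hV f η r]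

/-- Primitive classes are transported along an isomorphism `e : V ≅ V'`: if `x' ∈ Hⁱ(V')` is
primitive for `(L, e.inv^* η)` then `e.hom^* x' ∈ Hⁱ(V)` is primitive for `(L, η)`
(Kleiman 1968 §1.4; `e.hom^*` commutes with the Lefschetz operators). [folklore] -/
theorem isPrimitive_pullback_hom (hV : IsSmoothProjective N V) (hV' : IsSmoothProjective M V')
    (e : V ≅ V') {L : ℕ} {η : W.obj V 2} {i : ℕ} {x' : W.obj V' i}
    (hx' : W.IsPrimitive L (W.pullback e.inv 2 η) x') :
    W.IsPrimitive L η (W.pullback e.hom i x') := by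
  refine ⟨fun hi ↦ by rw [hx'.1 hi, map_zero], fun r j h hr ↦ ?_⟩
  have hη : W.pullback e.hom 2 (W.pullback e.inv 2 η) = η := W.pullback_hom_pullback_inv e 2 η
  conv_lhs => rw [← hη]
  rw [← W.pullback_lefschetzPow hV hV' e.hom, hx'.2 r j h hr, map_zero]

/-- **Kleiman's `⋆` is transported along an isomorphism** `e : V ≅ V'`: if `S` is a Lefschetz star
operator of `(V, η)` in dimension index `L` (`W.IsLefschetzStar`, Kleiman 1968 1.4.2), then
`e.inv^* ∘ S ∘ e.hom^*` is a Lefschetz star operator of `(V', e.inv^* η)`: pull-back along `e`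
commutes with `L` (`pullback_lefschetzPow`) and identifies primitive classes
(`isPrimitive_pullback_hom`). [cite: Kleiman1968, 1.4.2] -/
theorem isLefschetzStar_conj_of_iso (hV : IsSmoothProjective N V) (hV' : IsSmoothProjective M V')
    (e : V ≅ V') {L : ℕ} {η : W.obj V 2} {S : W.GradedOp V V} (hS : W.IsLefschetzStar L η S) :
    W.IsLefschetzStar L (W.pullback e.inv 2 η)
      (fun a b ↦ W.pullback e.inv b ∘ₗ S a b ∘ₗ W.pullback e.hom a) := by
  refine ⟨fun a b hab ↦ ?_, ?_⟩
  · show W.pullback e.inv b ∘ₗ S a b ∘ₗ W.pullback e.hom a = 0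
    rw [hS.1 a b hab, LinearMap.zero_comp, LinearMap.comp_zero]
  intro i x' hx' j s a b ha hb hjs
  have hx := W.isPrimitive_pullback_hom hV hV' e hx'
  have hη : W.pullback e.hom 2 (W.pullback e.inv 2 η) = η := W.pullback_hom_pullback_inv e 2 η
  simp only [LinearMap.comp_apply]
  rw [W.pullback_lefschetzPow hV hV' e.hom _ ha x', hη, hS.2 i _ hx j s a b ha hb hjs, map_zsmul,
    W.pullback_lefschetzPow hV' hV e.inv η hb, W.pullback_inv_pullback_hom]

end Iso

/-! ## The associativity isomorphism `(X × Y) × Z ≅ X × (Y × Z)` -/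

section Associator

variable {n m l : ℕ} {X Y Z : SchemeOver k}

/-- `α⁻¹^* p₁₂^* pr₁^* = pr₁'^*` (both are `π₁^*` on `X × (Y × Z)`). [folklore] -/
theorem pullback_associator_inv_fst_fst (i : ℕ) (a : W.obj X i) :
    W.pullback (α_ X Y Z).inv i (W.pullback (fst (X ⊗ Y) Z) i (W.pullback (fst X Y) i a)) =
      W.pullback (fst X (Y ⊗ Z)) i a := by
  have h : W.pullback (α_ X Y Z).inv i ∘ₗ W.pullback (fst (X ⊗ Y) Z) i ∘ₗ W.pullback (fst X Y) i =
      W.pullback (fst X (Y ⊗ Z)) i := by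
    rw [← W.pullback_comp, ← W.pullback_comp, associator_inv_fst_fst]
  exact LinearMap.congr_fun h a

/-- `α⁻¹^* p₁₂^* pr₂^* = pr₂'^* pr₁^*` (both are `π₂^*` on `X × (Y × Z)`). [folklore] -/
theorem pullback_associator_inv_fst_snd (i : ℕ) (b : W.obj Y i) :
    W.pullback (α_ X Y Z).inv i (W.pullback (fst (X ⊗ Y) Z) i (W.pullback (snd X Y) i b)) =
      W.pullback (snd X (Y ⊗ Z)) i (W.pullback (fst Y Z) i b) := by
  have h : W.pullback (α_ X Y Z).inv i ∘ₗ W.pullback (fst (X ⊗ Y) Z) i ∘ₗ W.pullback (snd X Y) i =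
      W.pullback (snd X (Y ⊗ Z)) i ∘ₗ W.pullback (fst Y Z) i := by
    rw [← W.pullback_comp, ← W.pullback_comp, associator_inv_fst_snd, W.pullback_comp]
  exact LinearMap.congr_fun h b

/-- `α⁻¹^* p₃^* = pr₂'^* pr₂^*` (both are `π₃^*` on `X × (Y × Z)`). [folklore] -/
theorem pullback_associator_inv_snd (i : ℕ) (c : W.obj Z i) :
    W.pullback (α_ X Y Z).inv i (W.pullback (snd (X ⊗ Y) Z) i c) =
      W.pullback (snd X (Y ⊗ Z)) i (W.pullback (snd Y Z) i c) := by
  have h : W.pullback (α_ X Y Z).inv i ∘ₗ W.pullback (snd (X ⊗ Y) Z) i =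
      W.pullback (snd X (Y ⊗ Z)) i ∘ₗ W.pullback (snd Y Z) i := by
    rw [← W.pullback_comp, associator_inv_snd, W.pullback_comp]
  exact LinearMap.congr_fun h c

/-- **The associator on triple external products**: `α⁻¹^* ((a ⊠ b) ⊠ c) = a ⊠ (b ⊠ c)`
(`map_cup`, `cup_assoc`, and the three projection identities). Degrees: `|a| = i`, `|b| = j`,
`|c| = q`, `i + j = ij`, `ij + q = d`, `j + q = jq`, `i + jq = d`. [folklore] -/
theorem pullback_associator_inv_externalCup (hX : IsSmoothProjective n X)
    (hY : IsSmoothProjective m Y) (hZ : IsSmoothProjective l Z) {i j ij q d jq : ℕ}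
    (hij : i + j = ij) (hd : ij + q = d) (hjq : j + q = jq) (hd' : i + jq = d) (a : W.obj X i)
    (b : W.obj Y j) (c : W.obj Z q) :
    W.pullback (α_ X Y Z).inv d (W.externalCup (X ⊗ Y) Z hd (W.externalCup X Y hij a b) c) =
      W.externalCup X (Y ⊗ Z) hd' a (W.externalCup Y Z hjq b c) := by
  have hXY := IsSmoothProjective.tensor_holds hX hY
  have hYZ := IsSmoothProjective.tensor_holds hY hZ
  have hV := IsSmoothProjective.tensor_holds hXY hZ
  have hV' := IsSmoothProjective.tensor_holds hX hYZ
  simp only [W.externalCup_apply]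
  rw [W.map_cup hV' hV (α_ X Y Z).inv hd, W.map_cup hV hXY (fst (X ⊗ Y) Z) hij,
    W.map_cup hV' hV (α_ X Y Z).inv hij, W.pullback_associator_inv_fst_fst,
    W.pullback_associator_inv_fst_snd, W.pullback_associator_inv_snd,
    W.map_cup hV' hYZ (snd X (Y ⊗ Z)) hjq, W.cup_assoc hV' hij hjq hd hd']

/-- **The trace is invariant under the associativity isomorphism**: for `X`, `Y`, `Z` smooth
projective of dimensions `n`, `m`, `l` and `w` of top degree on `(X × Y) × Z`,
`tr_{X×(Y×Z)} (α⁻¹^* w) = tr_{(X×Y)×Z} w` (any dimension index `N = n + m + l`). By Künneth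
induction (axiom (B), `kunneth_induction`) twice, `w` is a sum of triple external products
`(a ⊠ b) ⊠ c`; these map to `a ⊠ (b ⊠ c)` (`pullback_associator_inv_externalCup`) and both have
trace `tr a · tr b · tr c` in the top multidegree (`trace_externalCup`) and vanish otherwise
(`externalCup_eq_zero_of_ne`, axiom (A)). [cite: Kleiman1968, §1.2 (A), (B)] -/
theorem trace_pullback_associator_inv (hX : IsSmoothProjective n X) (hY : IsSmoothProjective m Y)
    (hZ : IsSmoothProjective l Z) {N : ℕ} (hN : n + m + l = N) (w : W.obj ((X ⊗ Y) ⊗ Z) (2 * N)) :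
    W.trace (X ⊗ (Y ⊗ Z)) N (W.pullback (α_ X Y Z).inv (2 * N) w) =
      W.trace ((X ⊗ Y) ⊗ Z) N w := by
  subst hN
  have hXY := IsSmoothProjective.tensor_holds hX hY
  have hYZ := IsSmoothProjective.tensor_holds hY hZ
  induction w using W.kunneth_induction hXY hZ with
  | zero => simp only [map_zero]
  | add w w' hw hw' => simp only [map_add, hw, hw']
  | ext ij q hd u c =>
    by_cases hij2 : ij = 2 * (n + m)
    · subst hij2
      obtain rfl : q = 2 * l := by omega
      induction u using W.kunneth_induction hX hY with
      | zero => simp only [map_zero, LinearMap.zero_apply]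
      | add u u' hu hu' => simp only [map_add, LinearMap.add_apply, hu, hu']
      | ext i j hij a b =>
        by_cases hi : i = 2 * n
        · subst hi
          obtain rfl : j = 2 * m := by omega
          rw [W.pullback_associator_inv_externalCup hX hY hZ hij hd
              (show 2 * m + 2 * l = 2 * (m + l) by omega)
              (show 2 * n + 2 * (m + l) = 2 * (n + m + l) by omega) a b c,
            W.trace_externalCup_of_eq hX hYZ (show n + (m + l) = n + m + l by omega),
            W.trace_externalCup' hY hZ, W.trace_externalCup' hXY hZ, W.trace_externalCup' hX hY,
            mul_assoc]
        · rw [W.externalCup_eq_zero_of_ne hX hY hij hi]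
          simp only [map_zero, LinearMap.zero_apply]
    · rw [W.externalCup_eq_zero_of_ne hXY hZ hd hij2]
      simp only [map_zero]

end Associator

/-! ## Push-forwards of motivated classes along `pr_X : X × Y → X` -/

section Pushforward

variable {n m : ℕ} {X Y : SchemeOver k}

/-- **The push-forward of a motivated class along `pr_X` is a motivated class** (André 1996,
§2.1, proof of Prop. 2.1 (ii), p. 15: «`pr^{XZ}_{X*} pr^{XZY}_{XZ*} (α ∪ ⋆β) = pr^{XZY}_{X*} (α ∪ ⋆β)`»),
for the generators `W.IsMotivatedClass`: if `z ∈ H^{2c}(X × Y)` is motivated with auxiliary data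
`(Z, η, ⋆, α, β)` on `(X × Y) × Z`, then `pr_{X*} z ∈ H^{2p}(X)` (`c = p + m`, push-forward in
complementary degree `2q`, `p + q = n`) is motivated with auxiliary variety `Y × Z` and the data
transported along `(X × Y) × Z ≅ X × (Y × Z)` (`isHyperplaneClass_pullback_of_isIso`,
`isLefschetzStar_conj_of_iso`, `pullback_ratAlgebraicClasses_le`); the projection formula for
`pr_{X*} z` is the adjunction `trace_cup_pushforward` followed by that of `z` and the invariance
of the trace `trace_pullback_associator_inv`. [cite: Andre1996Motifs, §2.1 Prop. 2.1 (ii) (p. 14), proof p. 15] -/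
theorem isMotivatedClass_pushforward_fst (hX : IsSmoothProjective n X) (hY : IsSmoothProjective m Y)
    {p q c : ℕ} (he : 2 * c + 2 * q = 2 * (n + m)) (hd : 2 * p + 2 * q = 2 * n)
    {z : W.obj (X ⊗ Y) (2 * c)} (hz : W.IsMotivatedClass (n + m) (X ⊗ Y) c z) :
    W.IsMotivatedClass n X p (W.pushforward (N := n + m) hX (fst X Y) he hd z) := by
  obtain ⟨l, Z, hZ, η, hη, S, hS, a, b, b', hbb', hab', α, β, hα, hβ, hrel⟩ := hz
  have hXY := IsSmoothProjective.tensor_holds hX hY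
  have hYZ := IsSmoothProjective.tensor_holds hY hZ
  have hV := IsSmoothProjective.tensor_holds hXY hZ
  have hV' := IsSmoothProjective.tensor_holds hX hYZ
  refine ⟨m + l, Y ⊗ Z, hYZ, W.pullback (α_ X Y Z).inv 2 η,
    W.isHyperplaneClass_pullback_of_isIso (α_ X Y Z).inv hη,
    fun i j ↦ W.pullback (α_ X Y Z).inv j ∘ₗ S i j ∘ₗ W.pullback (α_ X Y Z).hom i, ?_, a, b, b',
    by omega, by omega, W.pullback (α_ X Y Z).inv (2 * a) α, W.pullback (α_ X Y Z).inv (2 * b) β,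
    W.pullback_ratAlgebraicClasses_le hV' hV _ a ⟨α, hα, rfl⟩,
    W.pullback_ratAlgebraicClasses_le hV' hV _ b ⟨β, hβ, rfl⟩, ?_⟩
  · -- the transported Lefschetz involution
    rw [← Nat.add_assoc]
    exact W.isLefschetzStar_conj_of_iso hV hV' (α_ X Y Z) hS
  · -- the projection formula
    intro q' hq' y
    obtain rfl : q = q' := by omega
    have h1 := hrel q (by omega) (W.pullback (fst X Y) (2 * q) y)
    rw [PreWeilCohomology.cupPairing, LinearMap.compr₂_apply] at h1
    rw [PreWeilCohomology.cupPairing, LinearMap.compr₂_apply, W.trace_cup_pushforward, h1]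
    dsimp only
    rw [LinearMap.comp_apply, LinearMap.comp_apply, W.pullback_hom_pullback_inv,
      ← W.map_cup hV' hV (α_ X Y Z).inv, ← W.pullback_associator_inv_fst_fst (Y := Y) (Z := Z)
        (2 * q) y, ← W.map_cup hV' hV (α_ X Y Z).inv,
      W.trace_pullback_associator_inv hX hY hZ (show n + m + l = n + (m + l) by omega)]
    exact W.trace_cup_cup_congr (by omega) (by omega) _ _ _ _ α (S _ _ β) _

/-- **Discharge of the named fact `WeilCohomology.motivatedClasses_map_pushforward_fst_le`**
(André 1996, §2.1, Prop. 2.1 (ii), second inclusion `pr_{X*}(A_mot(X × Z)_E) ⊆ A_mot(X)_E`, p. 14;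
proof p. 15): for `X`, `Y` smooth projective of dimensions `n`, `m` and degrees
`2c + d' = 2(n + m)`, `2p + d' = 2n`, the push-forward `pr_{X*} = W.pushforward hX (fst X Y)` maps
the span `A_mot^c(X × Y)` into `A_mot^p(X)`. By linearity of `pr_{X*}` it suffices to treat the
generators (`isMotivatedClass_pushforward_fst`); `d' = 2q` with `p + q = n` is forced.
[cite: Andre1996Motifs, §2.1 Prop. 2.1 (ii) (p. 14), proof p. 15] -/
theorem motivatedClasses_map_pushforward_fst_le_holds :
    W.motivatedClasses_map_pushforward_fst_le := by
  intro n m X Y hX hY p c d' he hd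
  obtain ⟨q, rfl⟩ : ∃ q, d' = 2 * q := ⟨n - p, by omega⟩
  refine Submodule.map_le_iff_le_comap.mpr (Submodule.span_le.mpr fun z hz ↦ ?_)
  exact (W.isMotivatedClass_pushforward_fst hX hY he hd hz).mem_motivatedClasses

end Pushforward

end WeilCohomology

end Literature.AlgebraicGeometry.Motives

end
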